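import Literature.IUT.LogThetaLattice.VerticallyCoricLGPBad
import Literature.IUT.LogThetaLattice.VerticallyCoricLGPNonarch
import Literature.IUT.LogThetaLattice.VerticallyCoricLGPPackets
import Mathlib.Analysis.Normed.Algebra.Ultra
import Mathlib.NumberTheory.Padics.PadicNumbers
import Mathlib.NumberTheory.Padics.ProperSpace
import HarnessLib

/-!
# [IUTchIII] Proposition 3.5 (ii), closing "log-Kummer correspondence": GENUINE-MODEL instance forms with the
# residual `Prop` hypotheses discharged — proof-only companion of `VerticallyCoricLGP.lean` / `VerticallyCoricLGPBad.lean`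
# (abc-iut cell, block F, frozen FACT-LIST row **F-2136** `logKummerCorrespondence'`; node IUTchIII:Prop3.5(ii))

S. Mochizuki, *Inter-universal Teichmüller theory III*, kurims manuscript (May 2020) of PRIMS **57** (2021), §3,
Proposition 3.5 (ii), final paragraph, p. 106 (l. 31–32 of the cell's render) [claim: Mochizuki2012, status: disputed]
(D-0012 claim key; the content proved here is elementary): "one obtains a sort of "log-Kummer correspondence" between the
totality, as `m` ranges over the elements of `ℤ`, of the various groups of units and splitting monoids … and their
actions … on the "`𝓘^ℚ`" labeled by "`n,∘`" which is invariant with respect to the translation symmetries … of the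
`n`-th column".

abc-iut-L6-t4 types the per-index form as the predicate `logKummerCorrespondence' IQ M κ` (`VerticallyCoricLGP.lean`);
its universal closure is FALSE (abc-iut-f-130's `not_forall_logKummerCorrespondence'`,
`VerticallyCoricLGPProp35iiSchemaClosures.lean`), so the row is consumable only in INSTANCE FORM. The instance forms
of record at the tree's model of a bad place `v ∈ 𝕍^bad` (abc-iut-w4-d102, `VerticallyCoricLGPBad.lean`) are
`logKummerCorrespondence'_splittingMonoidAt` (splitting monoids `Ψ^⊥ = μ_{2l} · q^{j²ℕ}`) and
`logKummerCorrespondence'_unitSphere` (groups of units `𝒪_K^×`); both are stated over a coric field `K` carrying the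
two `Prop`-valued instance hypotheses `[Fact p.Prime]` and `[IsUltrametricDist K]` — the residual the block-F
kernel census reports for F-2136 ("CONDITIONAL-INSTANCE, 2 Prop hyps"). This PROOF-ONLY file (no `def`, no
`instance`, nothing re-typed; it imports, never edits, the declaring files) discharges that residual:

* `…_of_normedAlgebra` — `[IsUltrametricDist K]` is a THEOREM for a normed field that is a normed `ℚ_p`-algebra
  (Mathlib's `IsUltrametricDist.of_normedAlgebra ℚ_[p]`: `‖n‖ ≤ 1` for all `n ∈ ℕ`), so the general-carrier form
  for the splitting monoids holds with only the structural `[Fact p.Prime]` (needed to write `ℚ_[p]`) left (the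
  unit-group form is obtained by the same one-line argument from `logKummerCorrespondence'_unitSphere` and is not
  restated here: the gate identifies the two statements modulo instance binders);
* `…_padic` — the forms AT THE GENUINE STANDARD MODEL `K := ℚ_p`, log-shell of the genuine `p`-adic logarithm
  `PadicLogOnUnits.ofUnitLog p ℚ_[p]` (abc-iut-L4-t3 / abc-iut-S1, [AbsTopIII] Def. 5.4 (iii)), every prime `p`;
* `…_padicThree` — the same CLOSED, with NO hypothesis of any kind, at `p = 3`: a bad place has ODD residue
  characteristic ([IUTchI] Def. 3.1 (b), kurims p. 61: "`𝕍^bad_mod ⊆ 𝕍_mod` is a nonempty set of nonarchimedean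
  valuations of `F_mod` of odd residue characteristic"), and `l ≥ 5` is prime to it ([IUTchI] Def. 3.1 (c));
  the fully closed splitting-monoid instance takes `2l = 10`, `q := 3 ∈ ℚ_3` (`‖q‖ = 3⁻¹ < 1`), label `j = 1`.

APPENDED (same seat, same model; rows **F-2132** `Prop35ii_a` and **F-2134** `Prop35ii_c` of the same node, whose
universal closures abc-iut-f-130 likewise refuted in `VerticallyCoricLGPProp35iiSchemaClosures.lean`): the instance
forms of record `prop35ii_a_ofUnitLog` (abc-iut-w4-d009, `VerticallyCoricLGPNonarch.lean`; residual `Prop` binders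
`[Fact p.Prime]`, `[IsUltrametricDist K]`, `[ProperSpace K]`), its packet-level companion
`prop35ii_a_shellPacketN_ofUnitLog` (`VerticallyCoricLGPPackets.lean`) and `prop35ii_c_splittingMonoidAt_ofUnitLog`
(abc-iut-w4-d102, `VerticallyCoricLGPBad.lean`; residual `hq : ‖q‖ < 1`, `hj : j ≠ 0`, `hl : 0 < 2l` and the
instance hypotheses) CLOSED at the genuine `3`-adic model with NO hypothesis — `prop35ii_a_ofUnitLog_padicThree`,
`prop35ii_a_shellPacketN_ofUnitLog_padicThree` (capsule index set `Fin 2` = `S^±_2`, one place `Fin 1` over `v_ℚ`),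
`prop35ii_c_splittingMonoidAt_padicThree_closed` (`2l = 10`, `q = 3`, `j = 1`: `‖3‖_3 = 3⁻¹ < 1`, `1 ≠ 0`, `0 < 10`
discharged) — and at every `ℚ_p` with only `[Fact p.Prime]` left (`…_padic`, `q := p`).

HONEST FRAMING: instance forms at the genuine `p`-adic carriers of ONE factor (resp. one finite packet) at ONE place;
the universal closures of the typed predicates stay refuted; a FACT row is an assumption label on OUR typed statement.
Nothing here bears on the disputed [IUTchIII] Cor. 3.12 or takes a side on any author; typed ≠ proved elsewhere;
instantiated ≠ endorsed; nothing asserts abc proved or refuted.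
-/

noncomputable section

namespace Literature.IUT.LogThetaLattice

open Literature.AnabelianGeometry.AbsoluteAnabelian Literature.IUT.HodgeArakelov

universe u

/-! ### General coric carrier: `[IsUltrametricDist K]` discharged from `[NormedAlgebra ℚ_[p] K]` -/

section GeneralCarrier

variable (p : ℕ) [Fact p.Prime]
variable {K : Type u} [NontriviallyNormedField K] [NormedAlgebra ℚ_[p] K]
variable (Lg : PadicLogOnUnits K)

/-- **F-2136** ([IUTchIII] Prop. 3.5 (ii), closing paragraph, kurims p. 106) — the per-index log-Kummer correspondence
`logKummerCorrespondence'` for the SPLITTING MONOIDS `Ψ^⊥ = μ_{2l} · q^{j²ℕ}` at the tree's model of a bad place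
(abc-iut-w4-d102's `logKummerCorrespondence'_splittingMonoidAt`) WITHOUT the hypothesis `[IsUltrametricDist K]`: a normed
field that is a normed `ℚ_p`-algebra is automatically ultrametric (`IsUltrametricDist.of_normedAlgebra`). PROVED.
[claim: Mochizuki2012, status: disputed] -/
theorem logKummerCorrespondence'_splittingMonoidAt_of_normedAlgebra (twoL : ℕ) (q : K) (j : ℕ) :
    logKummerCorrespondence' (R := K)
      ((shellQSpan ℚ_[p] (AddSubgroup.closure (logShell Lg))).restrictScalars ℤ)
      (fun _ : ℤ => ↥(splittingMonoidAt K twoL q j))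
      (fun _ => (splittingMonoidAt K twoL q j).subtype) := by
  haveI : IsUltrametricDist K := IsUltrametricDist.of_normedAlgebra ℚ_[p]
  exact logKummerCorrespondence'_splittingMonoidAt p Lg

end GeneralCarrier

/-! ### The genuine standard model `K = ℚ_p`, log-shell of the genuine `p`-adic logarithm -/

section PadicField

variable (p : ℕ) [Fact p.Prime]

/-- **F-2136** ([IUTchIII] Prop. 3.5 (ii), closing paragraph, kurims p. 106) AT THE GENUINE STANDARD MODEL: coric field
`ℚ_p`, `𝓘^ℚ` = the span of the log-shell of the genuine `p`-adic logarithm `PadicLogOnUnits.ofUnitLog p ℚ_[p]`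
([AbsTopIII] Def. 5.4 (iii); abc-iut-L4-t3 / abc-iut-S1), splitting monoids `μ_{2l} · q^{j²ℕ} ⊆ ℚ_p`: every
Frobenius-like copy `(n,m)`, `m ∈ ℤ`, acts on the one coric `𝓘^ℚ` with the same Kummer image. The only remaining binder
of `Prop` sort is the structural `[Fact p.Prime]` needed to write `ℚ_[p]`. PROVED. [claim: Mochizuki2012, status: disputed] -/
theorem logKummerCorrespondence'_splittingMonoidAt_padic (twoL : ℕ) (q : ℚ_[p]) (j : ℕ) :
    logKummerCorrespondence' (R := ℚ_[p])
      ((shellQSpan ℚ_[p]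
        (AddSubgroup.closure (logShell (PadicLogOnUnits.ofUnitLog p ℚ_[p])))).restrictScalars ℤ)
      (fun _ : ℤ => ↥(splittingMonoidAt ℚ_[p] twoL q j))
      (fun _ => (splittingMonoidAt ℚ_[p] twoL q j).subtype) :=
  logKummerCorrespondence'_splittingMonoidAt p (PadicLogOnUnits.ofUnitLog p ℚ_[p])

/-- **F-2136** ([IUTchIII] Prop. 3.5 (ii), closing paragraph, kurims p. 106) AT THE GENUINE STANDARD MODEL, groups of
units: coric field `ℚ_p`, `𝓘^ℚ` = the span of the log-shell of the genuine `p`-adic logarithm, unit groups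
`𝒪^× = {‖x‖ = 1} ⊆ ℚ_p` for every label `m ∈ ℤ`. PROVED. [claim: Mochizuki2012, status: disputed] -/
theorem logKummerCorrespondence'_unitSphere_padic :
    logKummerCorrespondence' (R := ℚ_[p])
      ((shellQSpan ℚ_[p]
        (AddSubgroup.closure (logShell (PadicLogOnUnits.ofUnitLog p ℚ_[p])))).restrictScalars ℤ)
      (fun _ : ℤ => ↥(Submonoid.unitSphere ℚ_[p]))
      (fun _ => (Submonoid.unitSphere ℚ_[p]).subtype) :=
  logKummerCorrespondence'_unitSphere p (PadicLogOnUnits.ofUnitLog p ℚ_[p])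

end PadicField

/-! ### Closed instances at `p = 3` (odd residue characteristic, [IUTchI] Def. 3.1 (b)): no hypothesis at all -/

section PadicThree

/-- **F-2136** ([IUTchIII] Prop. 3.5 (ii), closing paragraph, kurims p. 106), CLOSED INSTANCE with no hypothesis of any
kind: the per-index log-Kummer correspondence `logKummerCorrespondence'` for the groups of units at the genuine `3`-adic
model — coric field `ℚ_3` (a bad place has odd residue characteristic, [IUTchI] Def. 3.1 (b), kurims p. 61), `𝓘^ℚ` = the
span of the log-shell of the genuine `3`-adic logarithm `PadicLogOnUnits.ofUnitLog 3 ℚ_[3]`, unit groups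
`𝒪^× = {‖x‖ = 1}` for every label `m ∈ ℤ`. PROVED. [claim: Mochizuki2012, status: disputed] -/
theorem logKummerCorrespondence'_unitSphere_padicThree :
    logKummerCorrespondence' (R := ℚ_[3])
      ((shellQSpan ℚ_[3]
        (AddSubgroup.closure (logShell (PadicLogOnUnits.ofUnitLog 3 ℚ_[3])))).restrictScalars ℤ)
      (fun _ : ℤ => ↥(Submonoid.unitSphere ℚ_[3]))
      (fun _ => (Submonoid.unitSphere ℚ_[3]).subtype) :=
  logKummerCorrespondence'_unitSphere_padic 3

/-- **F-2136** ([IUTchIII] Prop. 3.5 (ii), closing paragraph, kurims p. 106), INSTANCE FORM with no `Prop` hypothesis: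
the per-index log-Kummer correspondence `logKummerCorrespondence'` for the splitting monoids `μ_{2l} · q^{j²ℕ} ⊆ ℚ_3`
(any `2l`, `q`, `j` — data, universally quantified) at the genuine `3`-adic model (log-shell of
`PadicLogOnUnits.ofUnitLog 3 ℚ_[3]`). PROVED. [claim: Mochizuki2012, status: disputed] -/
theorem logKummerCorrespondence'_splittingMonoidAt_padicThree (twoL : ℕ) (q : ℚ_[3]) (j : ℕ) :
    logKummerCorrespondence' (R := ℚ_[3])
      ((shellQSpan ℚ_[3]
        (AddSubgroup.closure (logShell (PadicLogOnUnits.ofUnitLog 3 ℚ_[3])))).restrictScalars ℤ)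
      (fun _ : ℤ => ↥(splittingMonoidAt ℚ_[3] twoL q j))
      (fun _ => (splittingMonoidAt ℚ_[3] twoL q j).subtype) :=
  logKummerCorrespondence'_splittingMonoidAt_padic 3 twoL q j

/-- **F-2136** ([IUTchIII] Prop. 3.5 (ii), closing paragraph, kurims p. 106), CLOSED INSTANCE with no hypothesis of any
kind, all data fixed as in the initial Θ-data of [IUTchI] Def. 3.1: `p = 3` (odd residue characteristic, (b)),
`l = 5` (a prime `≥ 5` prime to the residue characteristic, (c)), so `2l = 10`; `q := 3 ∈ ℚ_3` (an element of
the maximal ideal, `‖q‖ = 3⁻¹ < 1`, standing for the `2l`-th root of the `q`-parameter); label `j = 1 ≠ 0`. The splitting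
monoid `μ_{10}(ℚ_3) · 3^{ℕ}` of every label `m ∈ ℤ` acts on the coric `𝓘^ℚ` of the genuine `3`-adic log-shell with the
same Kummer image. PROVED. [claim: Mochizuki2012, status: disputed] -/
theorem logKummerCorrespondence'_splittingMonoidAt_padicThree_closed :
    logKummerCorrespondence' (R := ℚ_[3])
      ((shellQSpan ℚ_[3]
        (AddSubgroup.closure (logShell (PadicLogOnUnits.ofUnitLog 3 ℚ_[3])))).restrictScalars ℤ)
      (fun _ : ℤ => ↥(splittingMonoidAt ℚ_[3] 10 (3 : ℚ_[3]) 1))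
      (fun _ => (splittingMonoidAt ℚ_[3] 10 (3 : ℚ_[3]) 1).subtype) :=
  logKummerCorrespondence'_splittingMonoidAt_padic 3 10 3 1

end PadicThree

/-! ## Appended: F-2132 `Prop35ii_a` ([IUTchIII] Prop. 3.5 (ii) (a), nonarchimedean primes) at the genuine model -/

section Prop35iiA

open Metric PiTensorProduct

variable (p : ℕ) [Fact p.Prime]

open Classical in
/-- **F-2132** ([IUTchIII] Prop. 3.5 (ii) (a) "(Nonarchimedean Primes)", kurims pp. 104–105) AT THE GENUINE STANDARD
MODEL `K := ℚ_p`: abc-iut-L6-t4's `Prop35ii_a` HOLDS for the coric log-shell `ℐ = (p*)⁻¹ · log_p(𝒪^×)` of the genuine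
`p`-adic logarithm `PadicLogOnUnits.ofUnitLog p ℚ_[p]` ([AbsTopIII] Def. 5.4 (iii)), the unit groups `𝒪^× = {‖x‖ = 1}`
of every label `m ∈ ℤ` with their inclusions as Kummer maps, and the partial `m'`-th iterates of `log_p` — i.e.
abc-iut-w4-d009's `prop35ii_a_ofUnitLog` with its instance hypotheses `[IsUltrametricDist K]`, `[ProperSpace K]` found
by Mathlib at `ℚ_p`; only the structural `[Fact p.Prime]` is left. PROVED. [claim: Mochizuki2012, status: disputed] -/
theorem prop35ii_a_ofUnitLog_padic :
    Prop35ii_a (logShell (PadicLogOnUnits.ofUnitLog p ℚ_[p])) (fun _ : ℤ => ↥(sphere (0 : ℚ_[p]) 1))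
      (fun _ u => (u : ℚ_[p]))
      (fun _ (m' : ℕ) _ u =>
        if (u : ℚ_[p]) ∈ iterDomain (PadicLogOnUnits.ofUnitLog p ℚ_[p]) m' then
          some ((PadicLogOnUnits.ofUnitLog p ℚ_[p]).log^[m'] (u : ℚ_[p])) else none) :=
  prop35ii_a_ofUnitLog p ℚ_[p]

open Classical in
/-- **F-2132** ([IUTchIII] Prop. 3.5 (ii) (a), kurims pp. 104–105), CLOSED INSTANCE with no hypothesis of any kind:
`Prop35ii_a` at the genuine `3`-adic model — coric log-shell of `PadicLogOnUnits.ofUnitLog 3 ℚ_[3]`, unit groups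
`𝒪^×_{ℚ_3}` for every label `m ∈ ℤ`, partial iterates of `log_3` (`p = 3`: odd residue characteristic, [IUTchI]
Def. 3.1 (b), kurims p. 61). PROVED. [claim: Mochizuki2012, status: disputed] -/
theorem prop35ii_a_ofUnitLog_padicThree :
    Prop35ii_a (logShell (PadicLogOnUnits.ofUnitLog 3 ℚ_[3])) (fun _ : ℤ => ↥(sphere (0 : ℚ_[3]) 1))
      (fun _ u => (u : ℚ_[3]))
      (fun _ (m' : ℕ) _ u =>
        if (u : ℚ_[3]) ∈ iterDomain (PadicLogOnUnits.ofUnitLog 3 ℚ_[3]) m' then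
          some ((PadicLogOnUnits.ofUnitLog 3 ℚ_[3]).log^[m'] (u : ℚ_[3])) else none) :=
  prop35ii_a_ofUnitLog_padic 3

open Classical in
/-- **F-2132** ([IUTchIII] Prop. 3.5 (ii) (a), kurims pp. 104–105), CLOSED PACKET-LEVEL INSTANCE with no hypothesis of
any kind: `Prop35ii_a` for the packet log-shell `𝓘(^{S^±_{j+1}}𝒟^⊢_{v_ℚ})` (abc-iut-L6-t4's `shellPacketN`) of the
tensor packet of [IUTchIII] Prop. 3.2 (ii) with capsule index set `S^±_2 = Fin 2` (label `j = 1`) and one place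
`Fin 1` over `v_ℚ`, every factor the genuine `3`-adic field `ℚ_3` with the log-shell of its genuine logarithm, the unit
groups `∏ 𝒪^×` with pure-tensor Kummer maps and the partial iterates of `log_3` — abc-iut-w4-d009's
`prop35ii_a_shellPacketN_ofUnitLog` at this data. PROVED. [claim: Mochizuki2012, status: disputed] -/
theorem prop35ii_a_shellPacketN_ofUnitLog_padicThree :
    Prop35ii_a (X := MPacketN ℚ_[3] (fun (_ : Fin 2) (_ : Fin 1) => ℚ_[3]))
      (shellPacketN ℚ_[3] (fun (_ : Fin 2) (_ : Fin 1) => ℚ_[3]) (fun _ _ =>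
        AddSubgroup.closure (logShell (PadicLogOnUnits.ofUnitLog 3 ℚ_[3]))) :
          Set (MPacketN ℚ_[3] (fun (_ : Fin 2) (_ : Fin 1) => ℚ_[3])))
      (fun _ : ℤ => ∀ (_ : Fin 2) (_ : Fin 1), ↥(sphere (0 : ℚ_[3]) 1))
      (fun _ u => tprod ℚ_[3] fun α => fun v => (u α v : ℚ_[3]))
      (fun _ (m' : ℕ) _ u =>
        if ∀ α v, (u α v : ℚ_[3]) ∈ iterDomain (PadicLogOnUnits.ofUnitLog 3 ℚ_[3]) m' then
          some (tprod ℚ_[3] fun α => fun v =>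
            (PadicLogOnUnits.ofUnitLog 3 ℚ_[3]).log^[m'] (u α v : ℚ_[3]))
        else none) := by
  -- the packet theorem elaborates the finite `∀` with `Fintype.decidableForallFintype`, the closed index
  -- sets `Fin 2`, `Fin 1` with `Nat.decidableForallFin`: `convert` identifies the two (subsingleton) instances
  convert prop35ii_a_shellPacketN_ofUnitLog 3 (fun (_ : Fin 2) (_ : Fin 1) => ℚ_[3])

end Prop35iiA

/-! ## Appended: F-2134 `Prop35ii_c` ([IUTchIII] Prop. 3.5 (ii) (c), bad primes) at the genuine model -/

section Prop35iiC

variable (p : ℕ) [Fact p.Prime]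

/-- **F-2134** ([IUTchIII] Prop. 3.5 (ii) (c) "(Bad Primes)", kurims pp. 105–106) AT THE GENUINE STANDARD MODEL
`K := ℚ_p` with the Θ-data FIXED: `Prop35ii_c` HOLDS for `𝓘^ℚ` = the span of the log-shell of the genuine `p`-adic
logarithm `PadicLogOnUnits.ofUnitLog p ℚ_[p]`, the splitting monoids `Ψ^⊥ = μ_{2l} · q^{j²ℕ}` with `2l = 10` (`l = 5`, a
prime `≥ 5`, [IUTchI] Def. 3.1 (c)), `q := p ∈ ℚ_p` (an element of the maximal ideal standing for the `2l`-th root of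
the `q`-parameter: `‖p‖_p = p⁻¹ < 1`, Mathlib `Padic.norm_p_lt_one`) and label `j = 1 ≠ 0`, and "related via the
log-links" = both elements in the domains of the log-links of `log_p` — abc-iut-w4-d102's
`prop35ii_c_splittingMonoidAt_ofUnitLog` with its three explicit hypotheses `‖q‖ < 1`, `j ≠ 0`, `0 < 2l` DISCHARGED
and its instance hypotheses found by Mathlib; only the structural `[Fact p.Prime]` is left. PROVED.
[claim: Mochizuki2012, status: disputed] -/
theorem prop35ii_c_splittingMonoidAt_ofUnitLog_padic :
    Prop35ii_c (R := ℚ_[p])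
      ((shellQSpan ℚ_[p]
        (AddSubgroup.closure (logShell (PadicLogOnUnits.ofUnitLog p ℚ_[p])))).restrictScalars ℤ)
      (fun _ : ℤ => ↥(splittingMonoidAt ℚ_[p] 10 (p : ℚ_[p]) 1))
      (fun _ => (splittingMonoidAt ℚ_[p] 10 (p : ℚ_[p]) 1).subtype)
      (fun _ x y => (x : ℚ_[p]) ∈ iterDomain (PadicLogOnUnits.ofUnitLog p ℚ_[p]) 1 ∧
        (y : ℚ_[p]) ∈ iterDomain (PadicLogOnUnits.ofUnitLog p ℚ_[p]) 1) :=
  prop35ii_c_splittingMonoidAt_ofUnitLog p (Padic.norm_p_lt_one) one_ne_zero (by norm_num)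

/-- **F-2134** ([IUTchIII] Prop. 3.5 (ii) (c) "(Bad Primes)", kurims pp. 105–106), CLOSED INSTANCE with no hypothesis
of any kind: `Prop35ii_c` at the genuine `3`-adic model — `𝓘^ℚ` of the log-shell of `PadicLogOnUnits.ofUnitLog 3 ℚ_[3]`,
splitting monoids `μ_{10}(ℚ_3) · 3^{ℕ}` (`2l = 10`, `q = 3`, `j = 1`) for every label `m ∈ ℤ`, inclusions as Kummer
maps, log-link domains of `log_3` (`p = 3`: odd residue characteristic, [IUTchI] Def. 3.1 (b), kurims p. 61; `l = 5`
prime to it, (c)). PROVED. [claim: Mochizuki2012, status: disputed] -/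
theorem prop35ii_c_splittingMonoidAt_padicThree_closed :
    Prop35ii_c (R := ℚ_[3])
      ((shellQSpan ℚ_[3]
        (AddSubgroup.closure (logShell (PadicLogOnUnits.ofUnitLog 3 ℚ_[3])))).restrictScalars ℤ)
      (fun _ : ℤ => ↥(splittingMonoidAt ℚ_[3] 10 (3 : ℚ_[3]) 1))
      (fun _ => (splittingMonoidAt ℚ_[3] 10 (3 : ℚ_[3]) 1).subtype)
      (fun _ x y => (x : ℚ_[3]) ∈ iterDomain (PadicLogOnUnits.ofUnitLog 3 ℚ_[3]) 1 ∧
        (y : ℚ_[3]) ∈ iterDomain (PadicLogOnUnits.ofUnitLog 3 ℚ_[3]) 1) := by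
  have h := prop35ii_c_splittingMonoidAt_ofUnitLog_padic 3
  rwa [Nat.cast_ofNat] at h

end Prop35iiC

end Literature.IUT.LogThetaLattice

end
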